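import Mathlib
import Summits.Ventures.HodgeRepro.Tier4.Common.MixedPlaneKType

/-!
# Tier4/Common/MixedPlaneCusp — Haar data on the tori (δ), isotropy of the plane, the unipotent radical of an
isotropic line and cuspidality as a DEFINED constant-term condition (ε) (t4-plan-4's V2 asks, S12240)

Blind re-derivation cell `pub-hodge-repro`, Tier 4 (README §9–§10), seat t4-typer-2 (gen 0).  Target tree path
`lean/Summits/Ventures/HodgeRepro/Tier4/Common/MixedPlaneCusp.lean`.  Imports `Tier4/Common/MixedPlaneKType.lean`
(hence `AdelicRTF`: `RTFData`, `periodLin`; `AdelicDefs`: `GA`, `adMat`, `GA.mat`).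

(δ) **`RTFData.IsHaar R`**: the two torus measures are Haar measures (Mathlib's `IsHaarMeasure`: left-invariant,
finite on compacts, positive on opens — the tori carry the subspace topology of the topological group `GL₄(𝔸_k)`)
and the two fundamental domains have positive finite measure — the clause that kills `μT = 0` (every period `0`)
and `μT = δ₁` (every period an evaluation) at once.
(ε) **Isotropy and cuspidality.**  `IsIsotropic W` — the trace form `B` has a non-zero isotropic vector over `k`
(for the hermitian form `h` of the plane, `B(ℓ, ℓ) = Tr h(ℓ, ℓ) = 2 h(ℓ, ℓ)`, so this is «`h` has an isotropic
vector», i.e. the plane is split and `U(U)` is quasi-split with a proper parabolic); for an isotropic `ℓ₀` the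
`E′`-line it spans is `ℓ₀, Ω ℓ₀`, and **`unipotentRadicalOf W ℓ₀ : Subgroup (GA W)`** is the group of elements of
`G(𝔸_k)` fixing that line pointwise and acting trivially on the quotient (`g v − v ∈ span(ℓ₀, Ω ℓ₀)` for all `v`) —
the unipotent radical `N(𝔸_k)` of the Borel stabilising the line; **`IsCuspidalWrt W N μN DN f`** := the constant
term `∫_{DN} f(n g) dμN(n)` vanishes for every `g` (`DN` a fundamental domain of `N(k)` in `N(𝔸_k)`, a parameter
with Mathlib's `IsFundamentalDomain` as the predicate a line states), and **`IsCuspidal`** := cuspidal along the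
unipotent radical of every isotropic line (vacuous — automatically true — when the plane is anisotropic, as it
should be: `[U(U)]` is then compact and every automorphic form is cuspidal).

Every object is defined; nothing here is a theorem about the intended objects beyond the subgroup closures;
nothing here says anything about the status of the Hodge conjecture for CM abelian varieties, which is NOT proved
(HC_CM is NOT proved by anyone in this repository).
-/

set_option autoImplicit false

noncomputable section

namespace Summit.Ventures.HodgeRepro.Tier4.Common

open NumberField Matrix MeasureTheory

section Haar

variable {k : Type} [Field k] [NumberField k] {W : PlaneData k}
  [MeasurableSpace (torusT W)] [MeasurableSpace (torusT' W)]

/-- **(δ) Haar data on the tori**: both measures are Haar measures and both fundamental domains have positive finite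
measure. -/
def RTFData.IsHaar (R : RTFData W) : Prop :=
  R.μT.IsHaarMeasure ∧ R.μT'.IsHaarMeasure ∧ 0 < R.μT R.DT ∧ R.μT R.DT < ⊤ ∧ 0 < R.μT' R.DT' ∧ R.μT' R.DT' < ⊤

end Haar

section Isotropy

variable {k : Type} [Field k] [NumberField k] (W : PlaneData k)

/-- **The plane is isotropic**: the trace form has a non-zero isotropic vector over `k` (⟺ the hermitian form has
one, since `B(ℓ, ℓ) = 2 h(ℓ, ℓ)` in characteristic `0`). -/
def IsIsotropic : Prop := ∃ ℓ : Fin 4 → k, ℓ ≠ 0 ∧ ℓ ⬝ᵥ (W.B *ᵥ ℓ) = 0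

/-- The plane is anisotropic. -/
def IsAnisotropic : Prop := ¬ IsIsotropic W

/-- An isotropic vector of the trace form. -/
def IsIsotropicVector (ℓ : Fin 4 → k) : Prop := ℓ ≠ 0 ∧ ℓ ⬝ᵥ (W.B *ᵥ ℓ) = 0

/-- The `E′`-line of `ℓ₀`, adelically: the `𝔸_k`-span of `ℓ₀` and `Ω ℓ₀`. -/
def adelicLine (ℓ₀ : Fin 4 → k) : Submodule (Ad k) (Fin 4 → Ad k) :=
  Submodule.span (Ad k) {fun i => algebraMap k (Ad k) (ℓ₀ i), fun i => algebraMap k (Ad k) ((W.Ω *ᵥ ℓ₀) i)}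

/-- The adelic vector of a `k`-vector. -/
def adVec (ℓ : Fin 4 → k) : Fin 4 → Ad k := fun i => algebraMap k (Ad k) (ℓ i)

/-- `g ∈ G(𝔸_k)` fixes the line of `ℓ₀` pointwise and acts trivially on the quotient. -/
def FixesLineUnipotently (ℓ₀ : Fin 4 → k) (g : GA W) : Prop :=
  GA.mat W g *ᵥ adVec ℓ₀ = adVec ℓ₀ ∧ GA.mat W g *ᵥ adVec (W.Ω *ᵥ ℓ₀) = adVec (W.Ω *ᵥ ℓ₀) ∧
    ∀ v : Fin 4 → Ad k, GA.mat W g *ᵥ v - v ∈ adelicLine W ℓ₀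

/-- The generators of the adelic line are in it. -/
theorem adVec_mem_adelicLine (ℓ₀ : Fin 4 → k) : adVec ℓ₀ ∈ adelicLine W ℓ₀ :=
  Submodule.subset_span (Or.inl rfl)

/-- The second generator of the adelic line is in it. -/
theorem adVec_omega_mem_adelicLine (ℓ₀ : Fin 4 → k) : adVec (W.Ω *ᵥ ℓ₀) ∈ adelicLine W ℓ₀ :=
  Submodule.subset_span (Or.inr rfl)

/-- An element fixing the line pointwise fixes every vector of the adelic line. -/
theorem mulVec_eq_self_of_mem_adelicLine (ℓ₀ : Fin 4 → k) {g : GA W} (hg : FixesLineUnipotently W ℓ₀ g)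
    {v : Fin 4 → Ad k} (hv : v ∈ adelicLine W ℓ₀) : GA.mat W g *ᵥ v = v := by
  have key : ∀ v ∈ adelicLine W ℓ₀, (Matrix.mulVecLin (GA.mat W g)) v = v := by
    intro v hv
    refine Submodule.span_induction ?_ ?_ ?_ ?_ hv
    · rintro x (rfl | rfl)
      · exact hg.1
      · exact hg.2.1
    · simp
    · intro x y _ _ hx hy
      rw [map_add, hx, hy]
    · intro a x _ hx
      rw [map_smul, hx]
  exact key v hv

/-- **The unipotent radical of the isotropic line `ℓ₀`**: the elements of `G(𝔸_k)` fixing the line pointwise and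
acting trivially on the quotient — a subgroup. -/
def unipotentRadicalOf (ℓ₀ : Fin 4 → k) : Subgroup (GA W) where
  carrier := {g | FixesLineUnipotently W ℓ₀ g}
  one_mem' := by
    refine ⟨by simp [GA.mat], by simp [GA.mat], fun v => ?_⟩
    simp [GA.mat]
  mul_mem' := by
    rintro g h ⟨hg1, hg2, hg3⟩ ⟨hh1, hh2, hh3⟩
    refine ⟨?_, ?_, fun v => ?_⟩
    · rw [GA.mat_mul, ← Matrix.mulVec_mulVec, hh1, hg1]
    · rw [GA.mat_mul, ← Matrix.mulVec_mulVec, hh2, hg2]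
    · rw [GA.mat_mul, ← Matrix.mulVec_mulVec]
      have e : GA.mat W g *ᵥ (GA.mat W h *ᵥ v) - v =
          (GA.mat W g *ᵥ (GA.mat W h *ᵥ v - v) - (GA.mat W h *ᵥ v - v)) + (GA.mat W h *ᵥ v - v) +
            (GA.mat W g *ᵥ v - v) := by
        simp only [Matrix.mulVec_sub]; abel
      rw [e]
      refine Submodule.add_mem _ (Submodule.add_mem _ ?_ (hh3 v)) (hg3 v)
      rw [mulVec_eq_self_of_mem_adelicLine W ℓ₀ ⟨hg1, hg2, hg3⟩ (hh3 v), sub_self]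
      exact Submodule.zero_mem _
  inv_mem' := by
    rintro g ⟨hg1, hg2, hg3⟩
    have hinv : ∀ v, GA.mat W g⁻¹ *ᵥ (GA.mat W g *ᵥ v) = v := by
      intro v
      rw [Matrix.mulVec_mulVec, GA.mat_inv_mul, Matrix.one_mulVec]
    have hinv' : ∀ v, GA.mat W g *ᵥ (GA.mat W g⁻¹ *ᵥ v) = v := by
      intro v
      rw [Matrix.mulVec_mulVec, GA.mat_mul_inv, Matrix.one_mulVec]
    refine ⟨?_, ?_, fun v => ?_⟩
    · conv_lhs => rw [← hg1]
      exact hinv _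
    · conv_lhs => rw [← hg2]
      exact hinv _
    · have := hg3 (GA.mat W g⁻¹ *ᵥ v)
      rw [hinv'] at this
      have e : GA.mat W g⁻¹ *ᵥ v - v = -(v - GA.mat W g⁻¹ *ᵥ v) := by abel
      rw [e]
      exact Submodule.neg_mem _ this

/-- Membership in the unipotent radical unfolded. -/
theorem mem_unipotentRadicalOf (ℓ₀ : Fin 4 → k) (g : GA W) :
    g ∈ unipotentRadicalOf W ℓ₀ ↔ FixesLineUnipotently W ℓ₀ g := Iff.rfl

end Isotropy

section Cuspidal

variable {k : Type} [Field k] [NumberField k] (W : PlaneData k)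

/-- **The constant term** of `f` along a subgroup `N` (the unipotent radical), over a fundamental domain `DN` of
`N(k)` in `N(𝔸_k)` with the measure `μN`: `g ↦ ∫_{DN} f(n g) dμN(n)`. -/
def constantTerm (N : Subgroup (GA W)) [MeasurableSpace N] (μN : Measure N) (DN : Set N) (f : GA W → ℂ)
    (g : GA W) : ℂ :=
  ∫ n in DN, f ((n : GA W) * g) ∂μN

/-- **`f` is cuspidal along `N`** (with the given Haar data): its constant term along `N` vanishes identically. -/
def IsCuspidalWrt (N : Subgroup (GA W)) [MeasurableSpace N] (μN : Measure N) (DN : Set N) (f : GA W → ℂ) : Prop :=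
  ∀ g : GA W, constantTerm W N μN DN f g = 0

/-- **(ε) `f` is cuspidal**: for every isotropic vector `ℓ₀`, every measurable structure, Haar measure and
fundamental domain of the rational points on its unipotent radical `N`, the constant term of `f` along `N` vanishes
(vacuous when the plane is anisotropic: no isotropic vector, every form is cuspidal). -/
def IsCuspidal (f : GA W → ℂ) : Prop :=
  ∀ ℓ₀ : Fin 4 → k, IsIsotropicVector W ℓ₀ →
    ∀ (_ : MeasurableSpace (unipotentRadicalOf W ℓ₀)) (μN : Measure (unipotentRadicalOf W ℓ₀))
      (DN : Set (unipotentRadicalOf W ℓ₀)), μN.IsHaarMeasure →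
      IsFundamentalDomain (rationalOf W (unipotentRadicalOf W ℓ₀)) DN μN →
      IsCuspidalWrt W (unipotentRadicalOf W ℓ₀) μN DN f

/-- A subspace is cuspidal when all its members are. -/
def IsCuspidalSubspace (V : Submodule ℂ (GA W → ℂ)) : Prop := ∀ f ∈ V, IsCuspidal W f

/-- On an anisotropic plane every function is cuspidal (no isotropic vector). -/
theorem isCuspidal_of_isAnisotropic (h : IsAnisotropic W) (f : GA W → ℂ) : IsCuspidal W f := by
  intro ℓ₀ hℓ₀
  exact absurd ⟨ℓ₀, hℓ₀.1, hℓ₀.2⟩ h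

end Cuspidal

end Summit.Ventures.HodgeRepro.Tier4.Common

end
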